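import Literature.IUT.HodgeArakelov.MonoThetaProjectiveProp16RefTF
import Literature.IUT.HodgeArakelov.MonoThetaProjectiveProp16EllipticRefIdentityWitnessTF
import HarnessLib

/-!
# [IUTchII] Prop. 1.6 (ii): the TF successor predicate `RefIsEllipticTF` HOLDS for the identity output, and
# `GenuineTF` is INHABITED at GENUINE FREE DATA (finding T1g11-F1 at layer L6; proof-only addendum to slice (b))

Cell `abc-iut` (run/shared/lean/pub/abc-iut/), layer L6, «L6 ROWS #6» PROP16-REF-TF (abc-iut-L6-lead §F v1.19eh):
slice (b) IDENTITY-TF WITNESS, Genuine half (seat abc-iut-L6-d7 gen 14), over slice (a)'s statement file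
`MonoThetaProjectiveProp16RefTF.lean` (abc-iut-L6-t7: `EllipticCuspidalization.RefIsEllipticTF`, `GenuineTF`) and
slice (b)'s `identityRecordTF` (p501476). PROOF-ONLY: no definition, no instance, no named fact; nothing landed is
edited. MERGE-MAP v55 §8S B18.

S. Mochizuki, *Inter-universal Teichmüller Theory II*, kurims manuscript (Dec. 2020), §1, Prop. 1.6 (ii) p. 31
l. 34–41 ("… `Π ↦ {Π_{U_N}(Π) ↠ Π}` … such that when `Π = Π^tp_{X̲̲_k}`, the surjection `Π_{U_N}(Π) ↠ Π` may be
naturally identified with a certain surjection — i.e., “elliptic cuspidalization” — that arises from a certain open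
immersion determined by the `N`-torsion points of a once-punctured elliptic curve …") [claim: Mochizuki2012, status:
disputed] (IUTchII §1 Prop 1.6 (ii), kurims p.31); [AbsTopII] Cor. 3.3 (iii) pp. 67–69
[cite: MochizukiAbsTopII2013, Cor 3.3 (iii) p.68]; [AbsTopI] Lemma 4.5 (i) p. 54 ("free pro-`Σ`")
[cite: MochizukiAbsTopI2012, Lemma 4.5 (i) p.54].

## What is shown (about the tree's own typed objects; nothing printed is asserted)
abc-iut-L6-t21's T1 identity witness `refIsElliptic_idOutput_self` / `nonempty_genuine_self` (p447116) for the
FROZEN-currency predicate carries the hypothesis `htf : IsMulTorsionFree E.geom`, UNSATISFIABLE at every tempered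
curve `X` whose `Δ̂_X` is free pro-`Σ` of rank `≥ 2` with two primes in `Σ` — where moreover the frozen `Genuine` is
EMPTY (abc-iut-L4-t17, `Summit.ABC.IUTFork.isEmpty_genuine_of_isFreeProOn_deltaHat`, p499351). Over the RE-POINTED
predicate of slice (a):
* **`refIsEllipticTF_idOutput_self`** — for every setting `S`, label `N`, tempered curve `X` with
  (R0)-identification `eX`, and junction datum `(E, iX)` for `Π̂_X` matching `Δ̂_X` whose `Δ` has NO NON-TRIVIAL
  ELEMENT OF FINITE ORDER (`htf⁰`, print's wording of [AbsTopII] Cor. 3.3 (ii)) and which has a centre-free normal open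
  `V`, the TF predicate `RefIsEllipticTF` HOLDS for the IDENTITY output `idOutput S N` at `U := X`, `eU := eX`:
  removed-cusp set `R = ∅`, clause (R2-TF) met by `identityRecordTF` (no cusps, `proj = 𝟙`, label `N`);
* **`nonempty_genuineTF_self`** — hence `EllipticCuspidalization.GenuineTF S N S.PiX X X eX` is inhabited with `U = X`;
* **`nonempty_genuineTF_self_of_isFreeProOn`** — at a tempered curve `X` whose `Δ̂_X` is free pro-`Σ` (ANY `Σ`, ANY
  rank: `hfree : IsFreeProOn ↥X.DeltaHat Σ gens`, p499351's hypothesis — the classical input «`Δ̂` of an affine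
  hyperbolic curve is free profinite», abc-iut-L5's `GeomOrigin.isFreeProOn`), `htf⁰` is DISCHARGED
  (`IsFreeProOn.torsionFree` transported along `iX`), so `GenuineTF S N S.PiX X X eX` is INHABITED for every junction
  datum with a centre-free normal open `V`; slim form `…_of_center_eq_bot` (`V := Π̂_X`, slimness);
READING (RQ7 T1 «inhabited from degeneracy», carried forward honestly): the re-point of (R2) to the TF record RESTORES
SATISFIABILITY of the v1 predicate at genuine free data — through the DEGENERATE output (no cusp removed, `N` a free
label) — and nothing more: the v2 chain predicate (slice (c), `RefIsEllipticChainTF` with the chain-realising conjunct)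
remains the content gate and stays identity-free by the ported non-degeneracy `not_of_refHom_eq_self`.
HONEST SCOPE: statements about OUR typing; no side is taken on [IUTchIII] Cor. 3.12; typed ≠ proved;
satisfiable-as-typed ≠ the printed reconstruction; nothing here asserts that abc is proved or refuted.
-/

noncomputable section

open CategoryTheory Topology

namespace Literature.IUT.HodgeArakelov

namespace EllipticCuspidalization

namespace IdentityWitness

open Literature.AnabelianGeometry.AbsoluteAnabelian
open Literature.AnabelianGeometry.SemiGraphs (TemperedCurve)

variable (S : ThetaSetting.{0}) (N : ℕ+) {p : ℕ} [Fact p.Prime] (X : TemperedCurve p) (eX : X.PiTemp ≃ₜ* S.PiX)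

/-- In a `T₁` group the closed normal subgroup generated by NO inertia groups is trivial. [folklore] -/
private theorem topologicalClosure_normalClosure_empty {G : Type*} [Group G] [TopologicalSpace G]
    [IsTopologicalGroup G] [T1Space G] {ι : Type*} (I : ι → Set G) :
    (Subgroup.normalClosure (⋃ x ∈ (∅ : Set ι), I x)).topologicalClosure = ⊥ := by
  have h0 : Subgroup.normalClosure (⋃ x ∈ (∅ : Set ι), I x) = ⊥ :=
    le_antisymm (Subgroup.normalClosure_le_normal (by simp)) bot_le
  rw [h0]
  apply SetLike.coe_injective
  rw [Subgroup.topologicalClosure_coe, Subgroup.coe_bot, closure_singleton]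

/-- **T1 WITNESS over the TF predicate.** For every setting `S`, label `N`, tempered curve `X` with
(R0)-identification `eX` (its tempered group is Hausdorff, `StableCurveTemperedData.t2Space_piTemp`), and junction
datum `(E, iX)` for `Π̂_X` matching `Δ̂_X` whose `Δ` has no non-trivial element of finite order and which has a
centre-free normal open `V`, the print-faithful successor predicate `RefIsEllipticTF` HOLDS for the identity output at
`U := X`, `eU := eX`: removed-cusp set `R = ∅`, clause (R2-TF) met by `identityRecordTF`.
[claim: Mochizuki2012, status: disputed] (IUTchII §1 Prop 1.6 (ii), kurims p.31) -/
theorem refIsEllipticTF_idOutput_self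
    (hR0 : X.DeltaTemp.map eX.toMulEquiv.toMonoidHom = S.DeltaX)
    (E : FundamentalExtension.{0}) (iX : X.PiHat ≃ₜ* E.arith)
    (hgeom : ∀ z : X.PiHat, iX z ∈ E.geom ↔ z ∈ X.DeltaHat)
    (htf : ∀ g : ↥E.geom, IsOfFinOrder g → g = 1) (V : Subgroup E.arith) [V.Normal]
    (hVo : IsOpen (V : Set E.arith)) (hVc : Subgroup.center V = ⊥) :
    (idOutput S N).RefIsEllipticTF X X eX eX where
  deltaTemp_eq := hR0
  K_eq := rfl
  continuous_projRef := continuous_id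
  aug_comp y := by rw [refHom_idOutput_apply]
  kernel_eq := by
    haveI := Literature.IUT.HodgeTheaters.StableCurveTemperedData.t2Space_piTemp X
    exact ⟨∅, fun _ h => h.elim,
      (ker_refHom_idOutput S N X eX).trans (topologicalClosure_normalClosure_empty _).symm,
      fun _ h => h.elim⟩
  elliptic := ⟨E, iX, identityRecordTF E N htf V hVo hVc, iX, rfl, hgeom, fun y => by
    rw [refHom_idOutput_apply]
    exact identityRecordTF_proj_arith_apply E N htf V hVo hVc _⟩

/-- **COROLLARY.** `EllipticCuspidalization.GenuineTF S N S.PiX X X eX` (slice (a)) is inhabited with `U = X` and the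
identity as «elliptic cuspidalization», under the same hypotheses.
[claim: Mochizuki2012, status: disputed] (IUTchII §1 Prop 1.6 (ii), kurims p.31) -/
theorem nonempty_genuineTF_self
    (hR0 : X.DeltaTemp.map eX.toMulEquiv.toMonoidHom = S.DeltaX)
    (E : FundamentalExtension.{0}) (iX : X.PiHat ≃ₜ* E.arith)
    (hgeom : ∀ z : X.PiHat, iX z ∈ E.geom ↔ z ∈ X.DeltaHat)
    (htf : ∀ g : ↥E.geom, IsOfFinOrder g → g = 1) (V : Subgroup E.arith) [V.Normal]
    (hVo : IsOpen (V : Set E.arith)) (hVc : Subgroup.center V = ⊥) :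
    Nonempty (EllipticCuspidalization.GenuineTF S N S.PiX X X eX) :=
  ⟨{ toEllipticCuspidalization := idOutput S N
     eU := eX
     refIsEllipticTF := refIsEllipticTF_idOutput_self S N X eX hR0 E iX hgeom htf V hVo hVc }⟩

/-- **GENUINE FREE DATA: `htf⁰` DISCHARGED.** At a tempered curve `X` whose `Δ̂_X` is free pro-`Σ` of finite rank
(ANY `Σ`, ANY rank — print's `X̲̲_k`, an affine hyperbolic curve, [AbsTopI] Lem. 4.5 (i)), for every junction datum
`(E, iX)` matching `Δ̂_X` with a centre-free normal open `V`, `GenuineTF S N S.PiX X X eX` is INHABITED (by the identity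
output) — whereas the frozen-currency `Genuine S N S.PiX X X eX` is EMPTY there for rank `≥ 2`, two primes in `Σ`
(p499351). [claim: Mochizuki2012, status: disputed] (IUTchII §1 Prop 1.6 (ii), kurims p.31) -/
theorem nonempty_genuineTF_self_of_isFreeProOn
    (hR0 : X.DeltaTemp.map eX.toMulEquiv.toMonoidHom = S.DeltaX)
    (E : FundamentalExtension.{0}) (iX : X.PiHat ≃ₜ* E.arith)
    (hgeom : ∀ z : X.PiHat, iX z ∈ E.geom ↔ z ∈ X.DeltaHat)
    {Sg : Set ℕ} {n : ℕ} {gens : Fin n → ↥X.DeltaHat} (hfree : IsFreeProOn ↥X.DeltaHat Sg gens)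
    (V : Subgroup E.arith) [V.Normal] (hVo : IsOpen (V : Set E.arith)) (hVc : Subgroup.center V = ⊥) :
    Nonempty (EllipticCuspidalization.GenuineTF S N S.PiX X X eX) := by
  -- transport `Δ̂_X ≃ₜ* Δ` along `iX` (abc-iut-L4-t17's `isFreeProOn_geom_of_deltaHat`, p499351, inlined:
  -- a Literature file cannot import a `Summits` module)
  let e : ↥X.DeltaHat ≃ₜ* ↥E.geom :=
    { toFun := fun z => ⟨iX z, (hgeom z).2 z.2⟩
      invFun := fun w => ⟨iX.symm w, (hgeom (iX.symm w)).1 (by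
        rw [ContinuousMulEquiv.apply_symm_apply]; exact w.2)⟩
      left_inv := fun z => Subtype.ext (iX.symm_apply_apply z)
      right_inv := fun w => Subtype.ext (iX.apply_symm_apply w)
      map_mul' := fun z w => Subtype.ext (map_mul iX _ _)
      continuous_toFun := (iX.continuous.comp continuous_subtype_val).subtype_mk _
      continuous_invFun := (iX.symm.continuous.comp continuous_subtype_val).subtype_mk _ }
  haveI : CompactSpace ↥E.geom := isCompact_iff_compactSpace.mp E.isClosed_geom.isCompact
  exact nonempty_genuineTF_self S N X eX hR0 E iX hgeom
    ((IsFreeProOn.of_continuousMulEquiv hfree e (gens := gens)).torsionFree) V hVo hVc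

/-- Centre of `Π` trivial ⇒ centre of the improper subgroup `⊤ ≤ Π` trivial. [folklore] -/
private theorem center_top_eq_bot_of_center {G : Type*} [Group G] (h : Subgroup.center G = ⊥) :
    Subgroup.center (⊤ : Subgroup G) = ⊥ := by
  refine eq_bot_iff.2 fun z hz => ?_
  have hz' : (z : G) ∈ Subgroup.center G := by
    rw [Subgroup.mem_center_iff]
    intro g
    exact congrArg Subtype.val (Subgroup.mem_center_iff.1 hz ⟨g, Subgroup.mem_top g⟩)
  rw [h] at hz'
  exact Subgroup.mem_bot.2 (Subtype.ext (Subgroup.mem_bot.1 hz'))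

/-- **GENUINE FREE DATA, slim form** (`V := Π̂_X` itself): free pro-`Σ` `Δ̂_X` and centre-free `Π̂_X ≅ E.arith`
(slimness, as for every hyperbolic curve) give an inhabitant of `GenuineTF S N S.PiX X X eX`.
[claim: Mochizuki2012, status: disputed] (IUTchII §1 Prop 1.6 (ii), kurims p.31) -/
theorem nonempty_genuineTF_self_of_isFreeProOn_of_center_eq_bot
    (hR0 : X.DeltaTemp.map eX.toMulEquiv.toMonoidHom = S.DeltaX)
    (E : FundamentalExtension.{0}) (iX : X.PiHat ≃ₜ* E.arith)
    (hgeom : ∀ z : X.PiHat, iX z ∈ E.geom ↔ z ∈ X.DeltaHat)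
    {Sg : Set ℕ} {n : ℕ} {gens : Fin n → ↥X.DeltaHat} (hfree : IsFreeProOn ↥X.DeltaHat Sg gens)
    (hZ : Subgroup.center E.arith = ⊥) :
    Nonempty (EllipticCuspidalization.GenuineTF S N S.PiX X X eX) :=
  nonempty_genuineTF_self_of_isFreeProOn S N X eX hR0 E iX hgeom hfree ⊤
    (by rw [Subgroup.coe_top]; exact isOpen_univ) (center_top_eq_bot_of_center hZ)

end IdentityWitness

end EllipticCuspidalization

end Literature.IUT.HodgeArakelov

end
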